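import Literature.MathematicalPhysics.QuantumFieldTheory.Balaban1983to89.B9Eq326LocalPartDivergenceBlockLetterSmallGauge
import Literature.MathematicalPhysics.QuantumFieldTheory.Balaban1983to89.B9Eq326LocalPartZerothOrderCoshRow
import Literature.MathematicalPhysics.QuantumFieldTheory.Balaban1983to89.B9Eq326LocalPartPointRow
import Literature.MathematicalPhysics.QuantumFieldTheory.Balaban1983to89.B9Eq326WeitzenbockHolonomyLetter
import Literature.MathematicalPhysics.QuantumFieldTheory.Balaban1983to89.B9Eq326LocalPartGradientRowAdjoint

/-!
# `Balaban1983to89.B9Eq326LocalPartDivergenceBlockLetterClosed` — T. Bałaban, *Propagators for lattice gauge theories in a background field*, Commun. Math.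
# Phys. **99** (1985) 389–434 [Balaban1985BackgroundPropagators] Thm 3.1 (3.42) p. 397 SECOND ENTRY *«|(∇_U Gλ)(x)| ≤ B₀e^{−δ₀d(y,y′)}|λ|, x ∈ Δ(y), supp λ ⊂
# Δ(y′)»* read for the local part `A₀ = Δ(U) + D_UD*_U + Q*aQ` of (3.26) p. 395 in its divergence form (the OWNER's plan v11 §2 (ii): the row of `D*_UA₀⁻¹`,
# bonds → sites), (3.8) p. 392, (3.49) p. 399, Thm 3.11 p. 416, with [Balaban1985Variational] (134)–(135) p. 298: **THE (L) LETTER OF `D*_U A₀⁻¹` IN THE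
# CELL's MODEL, CLOSED — for `f` supported over the bonds of ONE block `B(v)` with `sup‖f(b)‖ ≤ F`, at every site `y`:
# `‖(D*_U A₀⁻¹ f)(y)‖ ≤ 2e^{θ(L−1)}·(A + B·C_u)·F·e^{−r·d_m(B(y), v)}`, `C_u = (4∕γ)e^{r}√(d·L^d)`, `A = 2η⁻¹ΣB_ν`,
# `B = (2(η⁻¹(c_P + m) + d·η⁻²(b′ + b²)) + η⁻¹b∕β)·ΣB_ν`, `b = 2M_φM_φ′ε_U`, `b′ = 2M_φM_φ′a_U`,
# `c_P = p_K·e^{2θ} + k_Q·e^{θd(3L−1)} + η⁻²(d−1)δ_𝒦e^{2θ}`, `δ_𝒦 = 4M_φM_φ′δ` ((K59) `B9Eq326WeitzenbockHolonomyLetter.holonomy_letter`)** — composition BY NAME of this lineage's (K55)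
# `B9Eq326LocalPartDivergenceBlockLetterSmallGauge.norm_covDivL2K_le_blockLetter_smallGauge` (storey J's divergence row in the small-gauge model, (L) currency)
# with its three rows INHABITED: `hu` by the Kato form of `A₀` (`B9Eq326LocalPartKatoForm.localPart_eq_kato_add`) at `u := A₀⁻¹f` (`B11Eq103H1Complex.apply_greenK`),
# `hudec` by the NE9 OWNER t4-ne9-p1 g94's `B9Eq326LocalPartPointRow.norm_localInv_apply_le_blockDecay` (the pointwise block-decay row of `A₀⁻¹f` in the CLOSED
# windows of `B9Eq326LocalPartBlockDecayClosed`, `γ` displayed), `hPuv` by (K56) `B9Eq326LocalPartZerothOrderCoshRow.norm_zerothOrder_apply_le_weighted_cosh`;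
# the transporter contractions `hR`∕`hS` are derived from the model's mutual adjointness `hRS`.  WHAT STAYS DISPLAYED: the OWNER's MODEL letters verbatim
# (unitary `U(b) ∈ U1`, `hRS`, `*`-compatible fibre, trace datum, plaquette smallness `δ`, `‖U(b) − 1‖ ≤ ε_U`, the averaging data `hα1 hU1 hreg` + flat twins,
# `γ`-coercivity and the CLOSED radius windows), the bond-gradient datum `a_U`, `2 ≤ L·m_ν`, `1 ≤ d`, and the `cosh`-currency
# windows of storey J (`0 ≤ θ`, `r ≤ θL`, `2dη⁻²(cosh θ − 1) < m`, `β ≤ B_ν`, `θ ≤ κ′`, `η⁻¹B_ν ≤ C ≤ K∕√m`, `2η⁻¹b(e^{κ′}+1)dK ≤ √m`)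
# (successor memo `t4/b2b-balaban-t4-ne9-formalise-leaf-05/g85/STOREY-J-A0-MAP-g85.md` §3 (a)–(e): CLOSED in the model but for `a_U`, the windows and the
# transposed row `A₀⁻¹D_U` — (K58))

statement-level skeleton of published theorems with citation tags; proofs where landed; nothing here is a claim about the Yang–Mills mass gap

CITATION HEADER (lean-in-tree rule).  Audit cell `pub-balaban`, sub-cell `t4`, BINDER row NE9; filed by NE9 crux-team LEAF PROVER 05
(`b2b-balaban-t4-ne9-formalise-leaf-05`, gen 86).  Imports this lineage's (K55) `B9Eq326LocalPartDivergenceBlockLetterSmallGauge` and (K56)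
`B9Eq326LocalPartZerothOrderCoshRow`, (K59) `B9Eq326WeitzenbockHolonomyLetter` (the holonomy letter `δ_𝒦 = 4M_φM_φ′δ` of `𝒦` from the plaquette letters), and the
NE9 OWNER's `B9Eq326LocalPartPointRow` (through them `B9Eq326LocalPartKatoForm`, `B11Eq103H1Complex.greenK`).
SOURCE READ first-hand in the held text layer [Balaban1985BackgroundPropagators] (`paper:balaban1985-cmp99-background-propagators`): p. 397 Thm 3.1 (3.42);
p. 395 (3.26); p. 392 (3.8); p. 399 (3.49); p. 416 Thm 3.11; [Balaban1985Variational] p. 298 (134)–(135).  Print proves the gradient row by the random walk of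
Sect. 3 over the cubes of (3.35); the cell's road is storey J (a weighted sup-norm contraction) on top of the OWNER's Combes–Thomas block decay of `A₀⁻¹` —
[folklore] composition BY NAME; nothing printed is a hypothesis; the `[cite: …]` tags are TEXT LOCATIONS.

WHAT IS PROVED (sorry-free; 0 `def`; [folklore]).  §1 **`norm_covDivL2K_localInv_le_blockLetter`** — in the context of `B9Eq326LocalPartPointRow` §2 (the
one-step torus `T_{(L·m)}`, `ηL = 1`, the MODEL letters, `A₀ = hessOp + D_U∘D*_U + Q(U)†(a•Q(U))` at `Q := QtorusW`, `hpos₀`, the `γ`-coercivity and the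
CLOSED windows, `f` supported over `B(v)` with `‖f(b)‖ ≤ F`) together with `[∀ i, NeZero (m i)]`, `1 ≤ d`, `2 ≤ L·m_ν`, the bond-gradient datum `a_U` and
storey J's `cosh`-currency windows: the displayed (L) letter above for `D*_U(A₀⁻¹f)` at every site `y` (`δ_𝒦` discharged by (K59)).
§0 **`adjoint_eq_self_of_blockwise`** — a block family given pointwise by indicators is self-adjoint in the weighted `L²` space.
§2 **`norm_localInv_covDerivL2K_le_blockLetter`** — THE TRANSPOSED ROW: with `hessOp` symmetric and a site block family `PS` given pointwise, §1 through (K58)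
`B9Eq326LocalPartGradientRowAdjoint.transposed_blockLetter`: `‖(A₀⁻¹(D_Ug))(b)‖ ≤ (§1's constant)·L^d·e^{−r·d_m(B(b₋),u)}·G` for `g` supported over the sites of `B(u)`.
HONEST SCOPE.  Composition only; every constant symbolic and crude (the one-step price `√(d·L^d)`, the crude `k_Q`); `ε_U`, `a_U`, `δ_𝒦`, `δ`, `γ` are
the model's letters, not derived (t-freeness at `η⁻¹ = L` wants `Lε_U`, `L²a_U`, `L²δ` bounded — the (3.35)-type content of the model); the
windows are the consumer's arithmetic (`B9Eq342GradientRowComparisonMass(Uniform)`, `B9Eq342CoshWeightSite.exists_rate`); the transposed row pays the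
duality price `L^d` of (K58); nothing of [B9] Thm 3.1∕3.3∕3.11 is asserted, valued or discharged.  NOT NE9 (cell pub-balaban: NE9 NOT PRINTED ∕ NOT PROVED; «NE9 ⇐ the
named binders»; row WALLED ON A MODEL (O-NE9-1; #5 UNRULED); spine PROVED 0∕9; rung (B)+1 on a finite T⁴ — NOT infinite volume, NOT mass gap, NOT Clay;
HONEST DEPENDENCY: continuum YM on T⁴ ⇐ BetaPertH ∧ nine spine estimates (0/9 proved); BetaPertH ⇐ (D1) ∧ (D4) ∧ CAP+tail; G-an2-4 gates asym, D1
and NE2/3/4).  NEW file; nothing modified.  Net new unproved facts: 0.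
-/

noncomputable section

set_option autoImplicit false

open scoped InnerProductSpace ComplexConjugate BigOperators
open NormedSpace

namespace Literature.MathematicalPhysics.QuantumFieldTheory.Balaban1983to89.B9Eq326LocalPartDivergenceBlockLetterClosed

open B4Sect5Torus (TSite tdist)
open B4TorusKernel.MultiPeriod (circAbs)
open B9SectCLatticeCarrier (Bond DirPair bpos btgt shift unshift)
open B9Eq311L2Pairing (WL2)
open B9Eq319QprimeTorus (fineP blockCoord)
open B7Prop1Explicit (U1 Wcx boxVec)
open B11Eq103H1Complex (SiteL2K BondL2K greenK covDerivL2K covDivL2K apply_greenK)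
open B9Eq310DeltaPrime (reHol imHol)
open B9Eq310HessianOperator (adTransportW PlaqL2K curvOp hessOp)
open B9Eq315QTorus (perCfg cornerSite QtorusW)
open B9Eq326LocalPartKatoForm (bondLapK weitzOpK localPart_eq_kato_add)
open B9Eq326LocalPartPointRow (norm_localInv_apply_le_blockDecay)
open B9Eq326LocalPartZerothOrderCoshRow (norm_zerothOrder_apply_le_weighted_cosh)
open B9Eq326LocalPartDivergenceBlockLetterSmallGauge (norm_covDivL2K_le_blockLetter_smallGauge)
open B9Eq326WeitzenbockHolonomyLetter (holonomy_letter)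
open B9Eq326LocalPartGradientRowAdjoint (transposed_blockLetter)

/-! ## §0 A block family given pointwise by indicators is self-adjoint -/

section BlockAdjoint

variable {X Y : Type*} [Fintype X] [DecidableEq Y] {w : X → ℝ} [Fact (∀ x, 0 < w x)]
  {E : Type*} [NormedAddCommGroup E] [InnerProductSpace ℂ E] [FiniteDimensional ℂ E]

/-- **`P_y† = P_y` FOR A BLOCK FAMILY GIVEN POINTWISE**: if `(P_y f)(x) = f(x)` for `π x = y` and `0` otherwise, then `P_y` is self-adjoint in the weighted
`L²` space (`⟨P_yf, g⟩ = Σ_x w(x)⟨[πx = y]f(x), g(x)⟩ = ⟨f, P_yg⟩`) — the `hPBadj`∕`hPSadj` binders of (K58) `transposed_blockLetter` discharged from the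
pointwise letters `hPB`∕`hPS` themselves (cf. ne9-leaf-01's `B9Eq349KWAssembly.adjoint_eq_self_of_pointwise` for real multipliers). [folklore]
[cite: Balaban1985BackgroundPropagators, p.391 «The adjoints are taken with respect to natural L² scalar products», (3.49) p.399] -/
theorem adjoint_eq_self_of_blockwise (π : X → Y) (P : WL2 ℂ w E →L[ℂ] WL2 ℂ w E) (y : Y)
    (hP : ∀ (f : WL2 ℂ w E) (x : X), WL2.equiv ℂ w E (P f) x = if π x = y then WL2.equiv ℂ w E f x else 0) :
    ContinuousLinearMap.adjoint P = P := by
  symm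
  rw [ContinuousLinearMap.eq_adjoint_iff]
  intro f g
  rw [WL2.inner_def, WL2.inner_def]
  refine Finset.sum_congr rfl fun x _ => ?_
  rw [hP f x, hP g x]
  split_ifs <;> simp

end BlockAdjoint

variable {d : ℕ} (L : ℕ) [NeZero L] (m : Fin d → ℕ) [∀ i, NeZero (m i)] [∀ i, NeZero (fineP L m i)]
  {𝔸 : Type*} [NormedRing 𝔸] [StarRing 𝔸] [NormedAlgebra ℂ 𝔸] [StarModule ℂ 𝔸] [NormOneClass 𝔸] [CompleteSpace 𝔸] (hL : 1 ≤ L)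
  {W : Type*} [NormedAddCommGroup W] [InnerProductSpace ℂ W] [FiniteDimensional ℂ W] (φ : W ≃ₗ[ℂ] 𝔸) {Mφ Mφ' : ℝ}
  (hφ : ∀ w, ‖φ w‖ ≤ Mφ * ‖w‖) (hφ' : ∀ X, ‖φ.symm X‖ ≤ Mφ' * ‖X‖) (hMφ : 0 ≤ Mφ) (hMφ' : 0 ≤ Mφ') (hstar : ∀ X : 𝔸, ‖star X‖ ≤ ‖X‖)
  {c₀ c₁ : ℝ} [Fact (0 < c₀)] [Fact (0 < c₁)] {η : ℝ} (hη : 0 < η) (hηL : η * L = 1)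
  (U : Bond d (fineP L m) → 𝔸ˣ) (hU : ∀ b, U b ∈ U1 𝔸)
  (hRS : ∀ (b : Bond d (fineP L m)) (v u : W), ⟪adTransportW φ U b v, u⟫_ℂ = ⟪v, adTransportW φ (fun b => (U b)⁻¹) b u⟫_ℂ)
  {α : ℝ} (hα1 : α ≤ 1 / 64)
  (hU1 : ∀ (x : B7Prop1Explicit.Site d) (k : Fin d), perCfg (fineP L m) U x k ∈ U1 𝔸)
  (hreg : ∀ (y : TSite d m) (k : Fin d) (ρ : Fin d → Fin L),
    ‖((Wcx L (perCfg (fineP L m) U) (cornerSite L y) k (boxVec L ρ) : 𝔸ˣ) : 𝔸) - 1‖ ≤ α)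
  {α' : ℝ} (hα1' : α' ≤ 1 / 64)
  (hU1' : ∀ (x : B7Prop1Explicit.Site d) (k : Fin d), perCfg (fineP L m) (fun _ : Bond d (fineP L m) => (1 : 𝔸ˣ)) x k ∈ U1 𝔸)
  (hreg' : ∀ (y : TSite d m) (k : Fin d) (ρ : Fin d → Fin L),
    ‖((Wcx L (perCfg (fineP L m) (fun _ : Bond d (fineP L m) => (1 : 𝔸ˣ))) (cornerSite L y) k (boxVec L ρ) : 𝔸ˣ) : 𝔸) - 1‖ ≤ α')
  {εU : ℝ} (hεU : 0 ≤ εU) (hUε : ∀ b : Bond d (fineP L m), ‖(U b : 𝔸) - 1‖ ≤ εU)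
  (τ : 𝔸 →ₗ[ℂ] ℂ) {Mτ : ℝ} (hτ : ∀ X Y : 𝔸, ‖τ (X * Y)‖ ≤ Mτ * ‖X‖ * ‖Y‖) (hMτ : 0 ≤ Mτ)
  {δ : ℝ} (hδ : 0 ≤ δ)
  (hRe : ∀ p : B9SectCLatticeCarrier.Plaq d (fineP L m), ‖reHol U p - 1‖ ≤ δ)
  (hIm : ∀ p : B9SectCLatticeCarrier.Plaq d (fineP L m), ‖imHol U p‖ ≤ δ)
  (a : ℝ) (ha : 0 ≤ a) (hm : ∀ i, 1 ≤ m i)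
  (A₀ : BondL2K ℂ d (fineP L m) c₀ W →ₗ[ℂ] BondL2K ℂ d (fineP L m) c₀ W)
  (hA₀ : A₀ = hessOp φ η U τ + covDerivL2K ℂ c₀ ((η : ℂ))⁻¹ (adTransportW φ U) ∘ₗ covDivL2K ℂ c₀ ((η : ℂ))⁻¹ (adTransportW φ fun b => (U b)⁻¹) +
    LinearMap.adjoint (QtorusW L m hL φ U hα1 hU1 hreg (c₀ := c₀) (c₁ := c₁)) ∘ₗ
      ((a : ℂ) • QtorusW L m hL φ U hα1 hU1 hreg (c₀ := c₀) (c₁ := c₁)))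
  (hpos₀ : ∀ x : BondL2K ℂ d (fineP L m) c₀ W, x ≠ 0 → 0 < RCLike.re ⟪x, A₀ x⟫_ℂ)
  {γ β r : ℝ} (hγ : 0 < γ) (hβ : 0 ≤ β) (hr : 0 ≤ r)
  (hcoer : ∀ f : BondL2K ℂ d (fineP L m) c₀ W, γ * ‖f‖ ^ 2 ≤ RCLike.re ⟪f, A₀ f⟫_ℂ)
  (hwin : r * η ≤ 1) (hr4 : 4 * r ≤ 1)
  (hβCC : 4 * r * (Mφ * Mφ') * (d * Real.sqrt d) ≤ β) (hβC : 4 * r * (Mφ * Mφ') * d ≤ β) (hβD : 2 * r * (Mφ * Mφ') * Real.sqrt d ≤ β)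
  (hβQ : 8 * r * (Mφ' * Mφ * Real.sqrt (2 * (c₁ / c₀) * (2 * d * (102 * (d + 1) ^ 2 * L * εU) ^ 2 + ((L : ℝ) ^ d)⁻¹))) ≤ β)
  (small : (768 * Fintype.card (DirPair d) * Mτ * Mφ ^ 2 * (‖((η : ℂ)) ^ d‖ / c₀) * ‖((η : ℂ))⁻¹‖ ^ 2 * δ) / 2 + 3 * (2 + a) * β ^ 2 +
    8 * (r * η) * (768 * Fintype.card (DirPair d) * Mτ * Mφ ^ 2 * (‖((η : ℂ)) ^ d‖ / c₀) * ‖((η : ℂ))⁻¹‖ ^ 2 * δ) ≤ γ / 4)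
  (PB : TSite d m → BondL2K ℂ d (fineP L m) c₀ W →L[ℂ] BondL2K ℂ d (fineP L m) c₀ W)
  (hPB : ∀ (y : TSite d m) (f : BondL2K ℂ d (fineP L m) c₀ W) (b : Bond d (fineP L m)),
    WL2.equiv ℂ (fun _ : Bond d (fineP L m) => c₀) W (PB y f) b =
      if blockCoord L m (bpos b) = y then WL2.equiv ℂ (fun _ : Bond d (fineP L m) => c₀) W f b else 0)
  (v : TSite d m) (f : BondL2K ℂ d (fineP L m) c₀ W) {F : ℝ} (hF : 0 ≤ F)
  (hfv : ∀ b, blockCoord L m (bpos b) ≠ v → WL2.equiv ℂ (fun _ : Bond d (fineP L m) => c₀) W f b = 0)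
  (hfF : ∀ b, ‖WL2.equiv ℂ (fun _ : Bond d (fineP L m) => c₀) W f b‖ ≤ F)

include hφ hφ' hMφ hMφ' hstar hη hηL hU hRS hα1' hU1' hreg' hεU hUε hτ hMτ hδ hRe hIm ha hm hA₀ hγ hβ hr hcoer hwin hr4 hβCC hβC hβD hβQ small hPB hfv
  hfF hF in
/-- **THE (L) LETTER OF `D*_U A₀⁻¹` IN THE CELL's MODEL, CLOSED** — see the module header.  Beyond the model letters of
`B9Eq326LocalPartPointRow.norm_localInv_apply_le_blockDecay`: `1 ≤ d`, `2 ≤ L·m_ν`, the bond-gradient datum `a_U`, and storey J's `cosh`-currency windows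
(`θ`, `m`, `β`, `κ′`, `C`, `K`); the holonomy letter of `𝒦` is (K59)'s `4M_φM_φ′δ`.  Conclusion: for every site `y`,
`‖(D*_U(A₀⁻¹f))(y)‖ ≤ 2e^{θ(L−1)}·(A + B·C_u)·F·e^{−r·d_m(B(y),v)}` with the constants of the header. [folklore]
[cite: Balaban1985BackgroundPropagators, Thm 3.1 (3.42) p.397, (3.26) p.395, (3.8) p.392, (3.49) p.399, Thm 3.11 p.416; Balaban1985Variational, (134)–(135) p.298] -/
theorem norm_covDivL2K_localInv_le_blockLetter (hd : 1 ≤ d) (hn : ∀ ν, 2 ≤ fineP L m ν)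
    {aU : ℝ} (haU : 0 ≤ aU) (hUa : ∀ (x : TSite d (fineP L m)) (μ : Fin d), ‖(U (x, μ) : 𝔸) - (U (unshift μ x, μ) : 𝔸)‖ ≤ aU)
    -- storey J's `cosh` currency: rate `θ`, comparison mass `mm`, and the windows
    {θ mm : ℝ} (hθ : 0 ≤ θ) (hrθ : r ≤ θ * (L : ℝ)) (hmm : 0 < mm) (hlam : 2 * (d : ℝ) * η⁻¹ ^ 2 * (Real.cosh θ - 1) < mm)
    {β' : ℝ} (hβ' : 0 < β') (hβB : ∀ ν, β' ≤ (fun ν : Fin d => (1 + Real.exp (-θ)) *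
        ((1 + 2 * η⁻¹ / (fineP L m ν * Real.sqrt (mm - 2 * ((d : ℝ) - 1) * η⁻¹ ^ 2 * (Real.cosh θ - 1)))) /
          Real.sqrt ((mm - 2 * ((d : ℝ) - 1) * η⁻¹ ^ 2 * (Real.cosh θ - 1)) ^ 2 + 4 * (mm - 2 * ((d : ℝ) - 1) * η⁻¹ ^ 2 * (Real.cosh θ - 1)) * η⁻¹ ^ 2)) +
        2 * Real.sinh θ / (mm - 2 * (d : ℝ) * η⁻¹ ^ 2 * (Real.cosh θ - 1))) ν)
    {κ' C K : ℝ} (hθκ : θ ≤ κ') (hC : 0 ≤ C) (htB : ∀ ν, ‖((η⁻¹ : ℝ) : ℂ)‖ * (fun ν : Fin d => (1 + Real.exp (-θ)) *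
        ((1 + 2 * η⁻¹ / (fineP L m ν * Real.sqrt (mm - 2 * ((d : ℝ) - 1) * η⁻¹ ^ 2 * (Real.cosh θ - 1)))) /
          Real.sqrt ((mm - 2 * ((d : ℝ) - 1) * η⁻¹ ^ 2 * (Real.cosh θ - 1)) ^ 2 + 4 * (mm - 2 * ((d : ℝ) - 1) * η⁻¹ ^ 2 * (Real.cosh θ - 1)) * η⁻¹ ^ 2)) +
        2 * Real.sinh θ / (mm - 2 * (d : ℝ) * η⁻¹ ^ 2 * (Real.cosh θ - 1))) ν ≤ C)
    (hCK : C ≤ K / Real.sqrt mm) (hmK : 2 * ((|η⁻¹| * (2 * Mφ * Mφ' * εU)) * (Real.exp κ' + 1) * (d : ℝ) * K) ≤ Real.sqrt mm)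
    (y : TSite d (fineP L m)) :
    ‖WL2.equiv ℂ (fun _ : TSite d (fineP L m) => c₀) W
        (covDivL2K ℂ c₀ ((η : ℂ))⁻¹ (adTransportW φ fun b => (U b)⁻¹) (greenK A₀ hpos₀ f)) y‖ ≤
      2 * Real.exp (θ * ((L : ℝ) - 1)) *
        ((2 * ‖((η⁻¹ : ℝ) : ℂ)‖ * ∑ ν, (fun ν : Fin d => (1 + Real.exp (-θ)) *
        ((1 + 2 * η⁻¹ / (fineP L m ν * Real.sqrt (mm - 2 * ((d : ℝ) - 1) * η⁻¹ ^ 2 * (Real.cosh θ - 1)))) /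
          Real.sqrt ((mm - 2 * ((d : ℝ) - 1) * η⁻¹ ^ 2 * (Real.cosh θ - 1)) ^ 2 + 4 * (mm - 2 * ((d : ℝ) - 1) * η⁻¹ ^ 2 * (Real.cosh θ - 1)) * η⁻¹ ^ 2)) +
        2 * Real.sinh θ / (mm - 2 * (d : ℝ) * η⁻¹ ^ 2 * (Real.cosh θ - 1))) ν) +
          (2 * (‖((η⁻¹ : ℝ) : ℂ)‖ * (((768 * Fintype.card (DirPair d) * Mτ * Mφ ^ 2 * (‖((η : ℂ)) ^ d‖ / c₀) * ‖((η : ℂ))⁻¹‖ ^ 2 * δ * Real.exp θ ^ 2 +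
          |a| * (c₁ / c₀ * (Mφ' * (1 + 50 * (d + 1) * α) * Mφ) * ((2 * d : ℕ) : ℝ) * (Mφ' * (1 + 50 * (d + 1) * α) * Mφ)) *
            Real.exp (θ * (d : ℝ) * ((L : ℝ) * 2 + ((L : ℝ) - 1))) +
          ‖((η : ℂ))⁻¹ * ((η : ℂ))⁻¹‖ * ((d - 1 : ℝ) * (2 * Mφ * Mφ' * (2 * δ)) * Real.exp θ ^ 2)) + ‖((mm : ℝ) : ℂ)‖) +
              (d : ℝ) * (η⁻¹ ^ 2 * (2 * Mφ * Mφ' * aU + (2 * Mφ * Mφ' * εU) * (2 * Mφ * Mφ' * εU)))) + |η⁻¹| * (2 * Mφ * Mφ' * εU) / β') *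
            (∑ ν, (fun ν : Fin d => (1 + Real.exp (-θ)) *
        ((1 + 2 * η⁻¹ / (fineP L m ν * Real.sqrt (mm - 2 * ((d : ℝ) - 1) * η⁻¹ ^ 2 * (Real.cosh θ - 1)))) /
          Real.sqrt ((mm - 2 * ((d : ℝ) - 1) * η⁻¹ ^ 2 * (Real.cosh θ - 1)) ^ 2 + 4 * (mm - 2 * ((d : ℝ) - 1) * η⁻¹ ^ 2 * (Real.cosh θ - 1)) * η⁻¹ ^ 2)) +
        2 * Real.sinh θ / (mm - 2 * (d : ℝ) * η⁻¹ ^ 2 * (Real.cosh θ - 1))) ν)) * (4 / γ * Real.exp r * Real.sqrt (d * (L : ℝ) ^ d))) * F * Real.exp (-(r * tdist m (blockCoord L m y) v)) := by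
  -- the transporters are mutually inverse and, by `hRS`, contractions
  have hSR' : ∀ (b : Bond d (fineP L m)) (w : W), adTransportW φ (fun b => (U b)⁻¹) b (adTransportW φ U b w) = w := fun b w => by
    rw [B9Eq310HessianOperator.adTransportW_apply, B9Eq310HessianOperator.adTransportW_apply, LinearEquiv.apply_symm_apply, inv_inv]
    have h : (((U b)⁻¹ : 𝔸ˣ) : 𝔸) * ((U b : 𝔸) * φ w * ((U b)⁻¹ : 𝔸ˣ)) * (U b : 𝔸) = φ w := by
      rw [← mul_assoc, ← mul_assoc, Units.inv_mul, one_mul, mul_assoc, Units.inv_mul, mul_one]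
    rw [h, LinearEquiv.symm_apply_apply]
  have hRS' : ∀ (b : Bond d (fineP L m)) (w : W), adTransportW φ U b (adTransportW φ (fun b => (U b)⁻¹) b w) = w := fun b w => by
    rw [B9Eq310HessianOperator.adTransportW_apply, B9Eq310HessianOperator.adTransportW_apply, LinearEquiv.apply_symm_apply, inv_inv]
    have h : (U b : 𝔸) * ((((U b)⁻¹ : 𝔸ˣ) : 𝔸) * φ w * (U b : 𝔸)) * (((U b)⁻¹ : 𝔸ˣ) : 𝔸) = φ w := by
      rw [← mul_assoc, ← mul_assoc, Units.mul_inv, one_mul, mul_assoc, Units.mul_inv, mul_one]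
    rw [h, LinearEquiv.symm_apply_apply]
  have hR : ∀ (b : Bond d (fineP L m)) (w : W), ‖adTransportW φ U b w‖ ≤ ‖w‖ := fun b w => by
    have h1 : ⟪adTransportW φ U b w, adTransportW φ U b w⟫_ℂ = ⟪w, w⟫_ℂ := by rw [hRS, hSR']
    have h2 : ‖adTransportW φ U b w‖ ^ 2 = ‖w‖ ^ 2 := by
      rw [← inner_self_eq_norm_sq (𝕜 := ℂ), ← inner_self_eq_norm_sq (𝕜 := ℂ), h1]
    exact ((sq_eq_sq₀ (norm_nonneg _) (norm_nonneg _)).1 h2).le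
  have hS : ∀ (b : Bond d (fineP L m)) (w : W), ‖adTransportW φ (fun b => (U b)⁻¹) b w‖ ≤ ‖w‖ := fun b w => by
    have h1 : ⟪adTransportW φ (fun b => (U b)⁻¹) b w, adTransportW φ (fun b => (U b)⁻¹) b w⟫_ℂ = ⟪w, w⟫_ℂ := by
      rw [← hRS, hRS']
    have h2 : ‖adTransportW φ (fun b => (U b)⁻¹) b w‖ ^ 2 = ‖w‖ ^ 2 := by
      rw [← inner_self_eq_norm_sq (𝕜 := ℂ), ← inner_self_eq_norm_sq (𝕜 := ℂ), h1]
    exact ((sq_eq_sq₀ (norm_nonneg _) (norm_nonneg _)).1 h2).le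
  -- the Kato form of `A₀` at `u := A₀⁻¹f`
  have hinv : ((η : ℂ))⁻¹ = ((η⁻¹ : ℝ) : ℂ) := (Complex.ofReal_inv η).symm
  have hkato := localPart_eq_kato_add (hA₀ := hA₀)
  have hu : bondLapK ℂ c₀ ((η⁻¹ : ℝ) : ℂ) (adTransportW φ U) (adTransportW φ fun b => (U b)⁻¹) (greenK A₀ hpos₀ f) +
      (curvOp φ τ η U + LinearMap.adjoint (QtorusW L m hL φ U hα1 hU1 hreg (c₀ := c₀) (c₁ := c₁)) ∘ₗ ((a : ℂ) • QtorusW L m hL φ U hα1 hU1 hreg (c₀ := c₀) (c₁ := c₁)) -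
          (((η : ℂ))⁻¹ * ((η : ℂ))⁻¹) • weitzOpK ℂ c₀ (adTransportW φ U) (adTransportW φ fun b => (U b)⁻¹) :
          BondL2K ℂ d (fineP L m) c₀ W →ₗ[ℂ] BondL2K ℂ d (fineP L m) c₀ W) (greenK A₀ hpos₀ f) = f := by
    rw [← hinv]
    have e : bondLapK ℂ c₀ ((η : ℂ))⁻¹ (adTransportW φ U) (adTransportW φ fun b => (U b)⁻¹) (greenK A₀ hpos₀ f) +
        (curvOp φ τ η U + LinearMap.adjoint (QtorusW L m hL φ U hα1 hU1 hreg (c₀ := c₀) (c₁ := c₁)) ∘ₗ ((a : ℂ) • QtorusW L m hL φ U hα1 hU1 hreg (c₀ := c₀) (c₁ := c₁)) -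
          (((η : ℂ))⁻¹ * ((η : ℂ))⁻¹) • weitzOpK ℂ c₀ (adTransportW φ U) (adTransportW φ fun b => (U b)⁻¹) :
          BondL2K ℂ d (fineP L m) c₀ W →ₗ[ℂ] BondL2K ℂ d (fineP L m) c₀ W) (greenK A₀ hpos₀ f) =
        ((bondLapK ℂ c₀ ((η : ℂ))⁻¹ (adTransportW φ U) (adTransportW φ fun b => (U b)⁻¹) +
            LinearMap.adjoint (QtorusW L m hL φ U hα1 hU1 hreg (c₀ := c₀) (c₁ := c₁)) ∘ₗ ((a : ℂ) • QtorusW L m hL φ U hα1 hU1 hreg (c₀ := c₀) (c₁ := c₁))) +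
          (curvOp φ τ η U - (((η : ℂ))⁻¹ * ((η : ℂ))⁻¹) • weitzOpK ℂ c₀ (adTransportW φ U) (adTransportW φ fun b => (U b)⁻¹)) :
          BondL2K ℂ d (fineP L m) c₀ W →ₗ[ℂ] BondL2K ℂ d (fineP L m) c₀ W) (greenK A₀ hpos₀ f) := by
      simp only [LinearMap.add_apply, LinearMap.sub_apply]
      abel
    rw [e, ← hkato]
    exact apply_greenK hpos₀ f
  have ht : (0 : ℝ) < η⁻¹ := inv_pos.2 hη
  have hd1 : (0 : ℝ) ≤ (d : ℝ) - 1 := by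
    have : (1 : ℝ) ≤ d := by exact_mod_cast hd
    linarith
  have hα0 : 0 ≤ α := B9Eq316PenaltyLocalLetter.alpha_nonneg L m hL U hreg (v, ⟨0, hd⟩)
  have hc₀ : 0 < c₀ := Fact.out
  have hc₁ : 0 < c₁ := Fact.out
  have hcP1 : 0 ≤ 768 * Fintype.card (DirPair d) * Mτ * Mφ ^ 2 * (‖((η : ℂ)) ^ d‖ / c₀) * ‖((η : ℂ))⁻¹‖ ^ 2 * δ * Real.exp θ ^ 2 := by
    positivity
  have hcP2 : 0 ≤ |a| * (c₁ / c₀ * (Mφ' * (1 + 50 * (d + 1) * α) * Mφ) * ((2 * d : ℕ) : ℝ) * (Mφ' * (1 + 50 * (d + 1) * α) * Mφ)) *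
      Real.exp (θ * (d : ℝ) * ((L : ℝ) * 2 + ((L : ℝ) - 1))) := by
    have hK : 0 ≤ Mφ' * (1 + 50 * (d + 1) * α) * Mφ := by positivity
    positivity
  have hcP3 : 0 ≤ ‖((η : ℂ))⁻¹ * ((η : ℂ))⁻¹‖ * ((d - 1 : ℝ) * (2 * Mφ * Mφ' * (2 * δ)) * Real.exp θ ^ 2) :=
    mul_nonneg (norm_nonneg _) (mul_nonneg (mul_nonneg hd1 (by positivity)) (by positivity))
  have hcP : 0 ≤ (768 * Fintype.card (DirPair d) * Mτ * Mφ ^ 2 * (‖((η : ℂ)) ^ d‖ / c₀) * ‖((η : ℂ))⁻¹‖ ^ 2 * δ * Real.exp θ ^ 2 +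
          |a| * (c₁ / c₀ * (Mφ' * (1 + 50 * (d + 1) * α) * Mφ) * ((2 * d : ℕ) : ℝ) * (Mφ' * (1 + 50 * (d + 1) * α) * Mφ)) *
            Real.exp (θ * (d : ℝ) * ((L : ℝ) * 2 + ((L : ℝ) - 1))) +
          ‖((η : ℂ))⁻¹ * ((η : ℂ))⁻¹‖ * ((d - 1 : ℝ) * (2 * Mφ * Mφ' * (2 * δ)) * Real.exp θ ^ 2)) := add_nonneg (add_nonneg hcP1 hcP2) hcP3
  have hCu : 0 ≤ (4 / γ * Real.exp r * Real.sqrt (d * (L : ℝ) ^ d)) := by positivity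
  have h := norm_covDivL2K_le_blockLetter_smallGauge L m hm φ hφ hφ' hMφ hMφ' η⁻¹ mm θ hmm U hU hεU haU hUε hUa ht hθ hlam hn hR hS
    (curvOp φ τ η U + LinearMap.adjoint (QtorusW L m hL φ U hα1 hU1 hreg (c₀ := c₀) (c₁ := c₁)) ∘ₗ ((a : ℂ) • QtorusW L m hL φ U hα1 hU1 hreg (c₀ := c₀) (c₁ := c₁)) -
          (((η : ℂ))⁻¹ * ((η : ℂ))⁻¹) • weitzOpK ℂ c₀ (adTransportW φ U) (adTransportW φ fun b => (U b)⁻¹) :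
          BondL2K ℂ d (fineP L m) c₀ W →ₗ[ℂ] BondL2K ℂ d (fineP L m) c₀ W) (greenK A₀ hpos₀ f) f hu v hF hCu hr hrθ hcP
    (fun b hb => hfv b hb) hfF
    (fun b => (norm_localInv_apply_le_blockDecay L m hL φ hφ hφ' hMφ hMφ' hstar hη hηL U hU hRS hα1 hU1 hreg hα1' hU1' hreg' hεU hUε τ hτ hMτ hδ
      hRe hIm a ha hm A₀ hA₀ hpos₀ hγ hβ hr hcoer hwin hr4 hβCC hβC hβD hβQ small PB hPB v f hfv hfF b).trans (le_of_eq (by ring)))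
    (fun y' Nu hNu hv b => norm_zerothOrder_apply_le_weighted_cosh L m hL U hα1 hU1 hreg φ hMφ hφ hMφ' hφ' hm hθ τ hτ hMτ hstar η hU hδ hRe hIm a
      (((η : ℂ))⁻¹ * ((η : ℂ))⁻¹) (by positivity) (holonomy_letter U hU hRe hIm φ hφ hφ' hMφ hMφ' hR hS) (greenK A₀ hpos₀ f) y' Nu hNu hv b)
    hβ' hβB hθκ hC htB hCK hmK y
  have e2 : covDivL2K ℂ c₀ ((η : ℂ))⁻¹ (adTransportW φ fun b => (U b)⁻¹) =
      covDivL2K ℂ c₀ ((η⁻¹ : ℝ) : ℂ) (adTransportW φ fun b => (U b)⁻¹) := by rw [hinv]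
  rw [e2]
  exact h

include hφ hφ' hMφ hMφ' hstar hη hηL hU hRS hα1' hU1' hreg' hεU hUε hτ hMτ hδ hRe hIm ha hm hA₀ hγ hβ hr hcoer hwin hr4 hβCC hβC hβD hβQ small hPB in
/-- **THE TRANSPOSED ROW `A₀⁻¹D_U`, CLOSED** (plan v11 §2 (ii), second half): §1 inhabits the `hloc` of (K58)
`B9Eq326LocalPartGradientRowAdjoint.transposed_blockLetter`; beyond §1's hypotheses, `hessOp` symmetric (supplier `B9Eq310HessianHermitian.hessOp_isSymmetric`)
and a site block family `PS` given pointwise (`hPS`); the self-adjointness of `PB`∕`PS` is §0 (`adjoint_eq_self_of_blockwise`).  For `g` supported over the sites of `B(u)` with `‖g(x)‖ ≤ G`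
and every bond `b`: `‖(A₀⁻¹(D_U g))(b)‖ ≤ (the constant of §1)·L^d·e^{−r·d_m(B(b₋), u)}·G`. [folklore]
[cite: Balaban1985BackgroundPropagators, Thm 3.1 (3.42) p.397, (3.26) p.395, (3.8) p.392, (3.49) p.399, p.391; Balaban1985Variational, (134)–(135) p.298] -/
theorem norm_localInv_covDerivL2K_le_blockLetter (hd : 1 ≤ d) (hn : ∀ ν, 2 ≤ fineP L m ν)
    {aU : ℝ} (haU : 0 ≤ aU) (hUa : ∀ (x : TSite d (fineP L m)) (μ : Fin d), ‖(U (x, μ) : 𝔸) - (U (unshift μ x, μ) : 𝔸)‖ ≤ aU)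
    {θ mm : ℝ} (hθ : 0 ≤ θ) (hrθ : r ≤ θ * (L : ℝ)) (hmm : 0 < mm) (hlam : 2 * (d : ℝ) * η⁻¹ ^ 2 * (Real.cosh θ - 1) < mm)
    {β' : ℝ} (hβ' : 0 < β') (hβB : ∀ ν, β' ≤ (fun ν : Fin d => (1 + Real.exp (-θ)) *
        ((1 + 2 * η⁻¹ / (fineP L m ν * Real.sqrt (mm - 2 * ((d : ℝ) - 1) * η⁻¹ ^ 2 * (Real.cosh θ - 1)))) /
          Real.sqrt ((mm - 2 * ((d : ℝ) - 1) * η⁻¹ ^ 2 * (Real.cosh θ - 1)) ^ 2 + 4 * (mm - 2 * ((d : ℝ) - 1) * η⁻¹ ^ 2 * (Real.cosh θ - 1)) * η⁻¹ ^ 2)) +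
        2 * Real.sinh θ / (mm - 2 * (d : ℝ) * η⁻¹ ^ 2 * (Real.cosh θ - 1))) ν)
    {κ' C K : ℝ} (hθκ : θ ≤ κ') (hC : 0 ≤ C) (htB : ∀ ν, ‖((η⁻¹ : ℝ) : ℂ)‖ * (fun ν : Fin d => (1 + Real.exp (-θ)) *
        ((1 + 2 * η⁻¹ / (fineP L m ν * Real.sqrt (mm - 2 * ((d : ℝ) - 1) * η⁻¹ ^ 2 * (Real.cosh θ - 1)))) /
          Real.sqrt ((mm - 2 * ((d : ℝ) - 1) * η⁻¹ ^ 2 * (Real.cosh θ - 1)) ^ 2 + 4 * (mm - 2 * ((d : ℝ) - 1) * η⁻¹ ^ 2 * (Real.cosh θ - 1)) * η⁻¹ ^ 2)) +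
        2 * Real.sinh θ / (mm - 2 * (d : ℝ) * η⁻¹ ^ 2 * (Real.cosh θ - 1))) ν ≤ C)
    (hCK : C ≤ K / Real.sqrt mm) (hmK : 2 * ((|η⁻¹| * (2 * Mφ * Mφ' * εU)) * (Real.exp κ' + 1) * (d : ℝ) * K) ≤ Real.sqrt mm)
    (hH : (hessOp (c₀ := c₀) φ η U τ).IsSymmetric)
    (PS : TSite d m → SiteL2K ℂ d (fineP L m) c₀ W →L[ℂ] SiteL2K ℂ d (fineP L m) c₀ W)
    (hPS : ∀ (y : TSite d m) (g : SiteL2K ℂ d (fineP L m) c₀ W) (x : TSite d (fineP L m)),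
      WL2.equiv ℂ (fun _ : TSite d (fineP L m) => c₀) W (PS y g) x =
        if blockCoord L m x = y then WL2.equiv ℂ (fun _ : TSite d (fineP L m) => c₀) W g x else 0)
    (u : TSite d m) (g : SiteL2K ℂ d (fineP L m) c₀ W) (G : ℝ)
    (hgu : ∀ x, blockCoord L m x ≠ u → WL2.equiv ℂ (fun _ : TSite d (fineP L m) => c₀) W g x = 0)
    (hgG : ∀ x, ‖WL2.equiv ℂ (fun _ : TSite d (fineP L m) => c₀) W g x‖ ≤ G) (b : Bond d (fineP L m)) :
    ‖WL2.equiv ℂ (fun _ : Bond d (fineP L m) => c₀) W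
        (greenK A₀ hpos₀ (covDerivL2K ℂ c₀ ((η : ℂ))⁻¹ (adTransportW φ U) g)) b‖ ≤
      (2 * Real.exp (θ * ((L : ℝ) - 1)) *
        ((2 * ‖((η⁻¹ : ℝ) : ℂ)‖ * ∑ ν, (fun ν : Fin d => (1 + Real.exp (-θ)) *
        ((1 + 2 * η⁻¹ / (fineP L m ν * Real.sqrt (mm - 2 * ((d : ℝ) - 1) * η⁻¹ ^ 2 * (Real.cosh θ - 1)))) /
          Real.sqrt ((mm - 2 * ((d : ℝ) - 1) * η⁻¹ ^ 2 * (Real.cosh θ - 1)) ^ 2 + 4 * (mm - 2 * ((d : ℝ) - 1) * η⁻¹ ^ 2 * (Real.cosh θ - 1)) * η⁻¹ ^ 2)) +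
        2 * Real.sinh θ / (mm - 2 * (d : ℝ) * η⁻¹ ^ 2 * (Real.cosh θ - 1))) ν) +
          (2 * (‖((η⁻¹ : ℝ) : ℂ)‖ * (((768 * Fintype.card (DirPair d) * Mτ * Mφ ^ 2 * (‖((η : ℂ)) ^ d‖ / c₀) * ‖((η : ℂ))⁻¹‖ ^ 2 * δ * Real.exp θ ^ 2 +
          |a| * (c₁ / c₀ * (Mφ' * (1 + 50 * (d + 1) * α) * Mφ) * ((2 * d : ℕ) : ℝ) * (Mφ' * (1 + 50 * (d + 1) * α) * Mφ)) *
            Real.exp (θ * (d : ℝ) * ((L : ℝ) * 2 + ((L : ℝ) - 1))) +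
          ‖((η : ℂ))⁻¹ * ((η : ℂ))⁻¹‖ * ((d - 1 : ℝ) * (2 * Mφ * Mφ' * (2 * δ)) * Real.exp θ ^ 2)) + ‖((mm : ℝ) : ℂ)‖) +
              (d : ℝ) * (η⁻¹ ^ 2 * (2 * Mφ * Mφ' * aU + (2 * Mφ * Mφ' * εU) * (2 * Mφ * Mφ' * εU)))) + |η⁻¹| * (2 * Mφ * Mφ' * εU) / β') *
            (∑ ν, (fun ν : Fin d => (1 + Real.exp (-θ)) *
        ((1 + 2 * η⁻¹ / (fineP L m ν * Real.sqrt (mm - 2 * ((d : ℝ) - 1) * η⁻¹ ^ 2 * (Real.cosh θ - 1)))) /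
          Real.sqrt ((mm - 2 * ((d : ℝ) - 1) * η⁻¹ ^ 2 * (Real.cosh θ - 1)) ^ 2 + 4 * (mm - 2 * ((d : ℝ) - 1) * η⁻¹ ^ 2 * (Real.cosh θ - 1)) * η⁻¹ ^ 2)) +
        2 * Real.sinh θ / (mm - 2 * (d : ℝ) * η⁻¹ ^ 2 * (Real.cosh θ - 1))) ν)) * (4 / γ * Real.exp r * Real.sqrt (d * (L : ℝ) ^ d)))) * (L : ℝ) ^ d * Real.exp (-(r * tdist m (blockCoord L m (bpos b)) u)) * G := by
  have hc₀ : 0 < c₀ := Fact.out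
  have hc₁ : 0 < c₁ := Fact.out
  have ht : (0 : ℝ) < η⁻¹ := inv_pos.2 hη
  have hd1 : (0 : ℝ) ≤ (d : ℝ) - 1 := by
    have : (1 : ℝ) ≤ d := by exact_mod_cast hd
    linarith
  have hα0 : 0 ≤ α := B9Eq316PenaltyLocalLetter.alpha_nonneg L m hL U hreg (u, ⟨0, hd⟩)
  have hK0 : 0 ≤ Mφ' * (1 + 50 * (d + 1) * α) * Mφ := by positivity
  have hBC : 0 ≤ ∑ ν, (fun ν : Fin d => (1 + Real.exp (-θ)) *
        ((1 + 2 * η⁻¹ / (fineP L m ν * Real.sqrt (mm - 2 * ((d : ℝ) - 1) * η⁻¹ ^ 2 * (Real.cosh θ - 1)))) /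
          Real.sqrt ((mm - 2 * ((d : ℝ) - 1) * η⁻¹ ^ 2 * (Real.cosh θ - 1)) ^ 2 + 4 * (mm - 2 * ((d : ℝ) - 1) * η⁻¹ ^ 2 * (Real.cosh θ - 1)) * η⁻¹ ^ 2)) +
        2 * Real.sinh θ / (mm - 2 * (d : ℝ) * η⁻¹ ^ 2 * (Real.cosh θ - 1))) ν := by
    have hd0 : 0 < d := hd
    have hβle := hβB ⟨0, hd0⟩
    have hsum : ∀ ν, 0 ≤ (fun ν : Fin d => (1 + Real.exp (-θ)) *
        ((1 + 2 * η⁻¹ / (fineP L m ν * Real.sqrt (mm - 2 * ((d : ℝ) - 1) * η⁻¹ ^ 2 * (Real.cosh θ - 1)))) /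
          Real.sqrt ((mm - 2 * ((d : ℝ) - 1) * η⁻¹ ^ 2 * (Real.cosh θ - 1)) ^ 2 + 4 * (mm - 2 * ((d : ℝ) - 1) * η⁻¹ ^ 2 * (Real.cosh θ - 1)) * η⁻¹ ^ 2)) +
        2 * Real.sinh θ / (mm - 2 * (d : ℝ) * η⁻¹ ^ 2 * (Real.cosh θ - 1))) ν := fun ν => hβ'.le.trans (hβB ν)
    exact Finset.sum_nonneg fun ν _ => hsum ν
  have hB : 0 ≤ 2 * Real.exp (θ * ((L : ℝ) - 1)) *
        ((2 * ‖((η⁻¹ : ℝ) : ℂ)‖ * ∑ ν, (fun ν : Fin d => (1 + Real.exp (-θ)) *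
        ((1 + 2 * η⁻¹ / (fineP L m ν * Real.sqrt (mm - 2 * ((d : ℝ) - 1) * η⁻¹ ^ 2 * (Real.cosh θ - 1)))) /
          Real.sqrt ((mm - 2 * ((d : ℝ) - 1) * η⁻¹ ^ 2 * (Real.cosh θ - 1)) ^ 2 + 4 * (mm - 2 * ((d : ℝ) - 1) * η⁻¹ ^ 2 * (Real.cosh θ - 1)) * η⁻¹ ^ 2)) +
        2 * Real.sinh θ / (mm - 2 * (d : ℝ) * η⁻¹ ^ 2 * (Real.cosh θ - 1))) ν) +
          (2 * (‖((η⁻¹ : ℝ) : ℂ)‖ * (((768 * Fintype.card (DirPair d) * Mτ * Mφ ^ 2 * (‖((η : ℂ)) ^ d‖ / c₀) * ‖((η : ℂ))⁻¹‖ ^ 2 * δ * Real.exp θ ^ 2 +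
          |a| * (c₁ / c₀ * (Mφ' * (1 + 50 * (d + 1) * α) * Mφ) * ((2 * d : ℕ) : ℝ) * (Mφ' * (1 + 50 * (d + 1) * α) * Mφ)) *
            Real.exp (θ * (d : ℝ) * ((L : ℝ) * 2 + ((L : ℝ) - 1))) +
          ‖((η : ℂ))⁻¹ * ((η : ℂ))⁻¹‖ * ((d - 1 : ℝ) * (2 * Mφ * Mφ' * (2 * δ)) * Real.exp θ ^ 2)) + ‖((mm : ℝ) : ℂ)‖) +
              (d : ℝ) * (η⁻¹ ^ 2 * (2 * Mφ * Mφ' * aU + (2 * Mφ * Mφ' * εU) * (2 * Mφ * Mφ' * εU)))) + |η⁻¹| * (2 * Mφ * Mφ' * εU) / β') *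
            (∑ ν, (fun ν : Fin d => (1 + Real.exp (-θ)) *
        ((1 + 2 * η⁻¹ / (fineP L m ν * Real.sqrt (mm - 2 * ((d : ℝ) - 1) * η⁻¹ ^ 2 * (Real.cosh θ - 1)))) /
          Real.sqrt ((mm - 2 * ((d : ℝ) - 1) * η⁻¹ ^ 2 * (Real.cosh θ - 1)) ^ 2 + 4 * (mm - 2 * ((d : ℝ) - 1) * η⁻¹ ^ 2 * (Real.cosh θ - 1)) * η⁻¹ ^ 2)) +
        2 * Real.sinh θ / (mm - 2 * (d : ℝ) * η⁻¹ ^ 2 * (Real.cosh θ - 1))) ν)) * (4 / γ * Real.exp r * Real.sqrt (d * (L : ℝ) ^ d))) := by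
    have h3 : 0 ≤ ‖((η : ℂ))⁻¹ * ((η : ℂ))⁻¹‖ * ((d - 1 : ℝ) * (2 * Mφ * Mφ' * (2 * δ)) * Real.exp θ ^ 2) :=
      mul_nonneg (norm_nonneg _) (mul_nonneg (mul_nonneg hd1 (by positivity)) (by positivity))
    have hCP : 0 ≤ (768 * Fintype.card (DirPair d) * Mτ * Mφ ^ 2 * (‖((η : ℂ)) ^ d‖ / c₀) * ‖((η : ℂ))⁻¹‖ ^ 2 * δ * Real.exp θ ^ 2 +
          |a| * (c₁ / c₀ * (Mφ' * (1 + 50 * (d + 1) * α) * Mφ) * ((2 * d : ℕ) : ℝ) * (Mφ' * (1 + 50 * (d + 1) * α) * Mφ)) *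
            Real.exp (θ * (d : ℝ) * ((L : ℝ) * 2 + ((L : ℝ) - 1))) +
          ‖((η : ℂ))⁻¹ * ((η : ℂ))⁻¹‖ * ((d - 1 : ℝ) * (2 * Mφ * Mφ' * (2 * δ)) * Real.exp θ ^ 2)) :=
      add_nonneg (add_nonneg (by positivity) (by positivity)) h3
    have hCU : 0 ≤ (4 / γ * Real.exp r * Real.sqrt (d * (L : ℝ) ^ d)) := by positivity
    have hε2 : 0 ≤ (d : ℝ) * (η⁻¹ ^ 2 * (2 * Mφ * Mφ' * aU + (2 * Mφ * Mφ' * εU) * (2 * Mφ * Mφ' * εU))) := by positivity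
    have hlast : 0 ≤ |η⁻¹| * (2 * Mφ * Mφ' * εU) / β' := by positivity
    have h2exp : 0 ≤ 2 * Real.exp (θ * ((L : ℝ) - 1)) := by positivity
    have hA : 0 ≤ 2 * ‖((η⁻¹ : ℝ) : ℂ)‖ * ∑ ν, (fun ν : Fin d => (1 + Real.exp (-θ)) *
        ((1 + 2 * η⁻¹ / (fineP L m ν * Real.sqrt (mm - 2 * ((d : ℝ) - 1) * η⁻¹ ^ 2 * (Real.cosh θ - 1)))) /
          Real.sqrt ((mm - 2 * ((d : ℝ) - 1) * η⁻¹ ^ 2 * (Real.cosh θ - 1)) ^ 2 + 4 * (mm - 2 * ((d : ℝ) - 1) * η⁻¹ ^ 2 * (Real.cosh θ - 1)) * η⁻¹ ^ 2)) +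
        2 * Real.sinh θ / (mm - 2 * (d : ℝ) * η⁻¹ ^ 2 * (Real.cosh θ - 1))) ν := by positivity
    exact mul_nonneg h2exp (add_nonneg hA (mul_nonneg (mul_nonneg (mul_nonneg zero_le_two (add_nonneg
      (mul_nonneg (norm_nonneg _) (add_nonneg (add_nonneg hCP (norm_nonneg _)) hε2)) hlast)) hBC) hCU))
  classical
  have hPBadj : ∀ y, ContinuousLinearMap.adjoint (PB y) = PB y := fun y' =>
    adjoint_eq_self_of_blockwise (fun b : Bond d (fineP L m) => blockCoord L m (bpos b)) (PB y') y' (hPB y')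
  have hPSadj : ∀ y, ContinuousLinearMap.adjoint (PS y) = PS y := fun y' =>
    adjoint_eq_self_of_blockwise (blockCoord L m) (PS y') y' (hPS y')
  exact transposed_blockLetter L m hm φ τ η U hRS hH _ a A₀ hA₀ hpos₀ PB hPB hPBadj PS hPS hPSadj hB
    (fun v' f' F' hfv' hfF' y => (norm_covDivL2K_localInv_le_blockLetter L m hL φ hφ hφ' hMφ hMφ' hstar hη hηL U hU hRS hα1 hU1 hreg hα1' hU1' hreg'
      hεU hUε τ hτ hMτ hδ hRe hIm a ha hm A₀ hA₀ hpos₀ hγ hβ hr hcoer hwin hr4 hβCC hβC hβD hβQ small PB hPB v' f' ((norm_nonneg _).trans (hfF' b))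
      hfv' hfF' hd hn haU hUa hθ hrθ hmm hlam hβ' hβB hθκ hC htB hCK hmK y).trans (le_of_eq (by ring)))
    u g G hgu hgG b

end Literature.MathematicalPhysics.QuantumFieldTheory.Balaban1983to89.B9Eq326LocalPartDivergenceBlockLetterClosed

end
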